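import Literature.Probability.LatticeModels.GKSInequalities
import Literature.Probability.LatticeModels.ModifiedSimonInequality
import Literature.Probability.LatticeModels.LoopO1
import Literature.Combinatorics.SimpleGraph.CycleSpaceSeparators
import Summits.CriticalPhenomena.Ising3DConformalLimit.Theorems.FKParityRobustnessStrandShadowComposition
import HarnessLib

/-!
# `StrandShadow` (stmt-CriticalPhenomena-14626), line `Sketch`: the clean glue `C′ → IndependentStrandsJoin`

Lead's helper file (`--supports stmt-CriticalPhenomena-14626`).  The route glue `ShadowGivesJoin`
(stmt-14649, proved: `strandsJoin_of_shadow_of_depletion` in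
`Theorems/FKParityRobustnessShadowGivesJoin.lean`) consumes the FORMAL crux, whose left side carries
the free-`isingCorr` junk value `1` on the configurations whose `a₀`-cluster swallows `a₂` and `a₃`.
Here the same finite-graph argument is run with the CLEAN hypothesis (`C′ = StrandShadowClean` of
`Cruxes/StrandShadow/Disproof.lean` §2 at one scale: the `F`-sum restricted to the configurations whose
`a₀`-cluster reaches neither `a₂` nor `a₃`): `strandsJoin_of_cleanShadow_of_depletion`.  In the
swallowed case the meeting is sure and the depleted correlation is not needed, so nothing is lost —
restating the crux as `C′` costs the route nothing downstream.  Proof adapted verbatim from the landed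
`strandsJoin_of_shadow_of_depletion` (prover of stmt-14649), with `D(F) := 1[F clean]·⟨σ₂σ₃⟩_{depl F}`.
-/

noncomputable section

open Finset SimpleGraph Literature.Probability.LatticeModels
open Literature.Combinatorics.SimpleGraph.CycleSpace
open Summit.CriticalPhenomena.Ising3DConformalLimit.Theorems.StrandShadowSketch

namespace Summit.CriticalPhenomena.Ising3DConformalLimit.Theorems.StrandShadowSketch

open scoped Classical

section General

variable {V : Type*} [Fintype V] [DecidableEq V] (G : SimpleGraph V) [DecidableRel G.Adj]

/-- GKS I without `A ⊆ Λ` (the outside part of `A` is junk `+1`): pair case. -/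
theorem isingCorr_free_pair_nonneg (Λ : Finset V) {β : ℝ} (hβ : 0 ≤ β) (x y : V) :
    0 ≤ isingCorr G Λ β 0 .free {x, y} := by
  rw [isingCorr_free_pair_eq_inter]
  exact GKSInequalities.gks_one_holds G hβ le_rfl (Or.inl rfl) Finset.inter_subset_right

set_option maxHeartbeats 400000 in
/-- **Finite-graph core of the CLEAN glue**: the depletion bound at the pair `a₂a₃` (all `S ∌ a₂,a₃`)
and the CLEAN shadow inequality with constant `c` give
`c · Z(a₀a₁) · Z(a₂a₃) ≤ Σ_{F₁} Σ_{F₂} t^{|F₁|+|F₂|} 1[a₀ ↝ a₂ in F₁ ∪ F₂]`. -/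
theorem strandsJoin_of_cleanShadow_of_depletion {β c : ℝ} (hβ : 0 ≤ β) (a : Fin 4 → V)
    (hD : ∀ S : Finset V, a 2 ∉ S → a 3 ∉ S →
      (∑ F ∈ (tJoins G Set.univ {a 2, a 3}).filter (fun F : Finset (Sym2 V) =>
          ∀ v ∈ S, ¬ (SimpleGraph.fromEdgeSet (↑F : Set (Sym2 V))).Reachable (a 2) v),
          Real.tanh β ^ F.card) * isingCorr G Finset.univ β 0 .free {a 2, a 3} ≤
        loopO1PartitionFunction G (Real.tanh β) {a 2, a 3} *
          isingCorr G (Finset.univ \ S) β 0 .free {a 2, a 3})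
    (hS : ∑ F ∈ (tJoins G Set.univ {a 0, a 1}).filter (fun F : Finset (Sym2 V) =>
          ¬ (SimpleGraph.fromEdgeSet (↑F : Set (Sym2 V))).Reachable (a 0) (a 2) ∧
          ¬ (SimpleGraph.fromEdgeSet (↑F : Set (Sym2 V))).Reachable (a 0) (a 3)),
        Real.tanh β ^ F.card *
        isingCorr G (Finset.univ.filter (fun v : V =>
          ¬ (SimpleGraph.fromEdgeSet (↑F : Set (Sym2 V))).Reachable (a 0) v)) β 0 .free {a 2, a 3} ≤
      (1 - c) * loopO1PartitionFunction G (Real.tanh β) {a 0, a 1} *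
        isingCorr G Finset.univ β 0 .free {a 2, a 3}) :
    c * loopO1PartitionFunction G (Real.tanh β) {a 0, a 1} *
        loopO1PartitionFunction G (Real.tanh β) {a 2, a 3} ≤
      ∑ F₁ ∈ tJoins G Set.univ {a 0, a 1}, ∑ F₂ ∈ tJoins G Set.univ {a 2, a 3},
        if (SimpleGraph.fromEdgeSet ((↑F₁ : Set (Sym2 V)) ∪ ↑F₂)).Reachable (a 0) (a 2)
        then Real.tanh β ^ (F₁.card + F₂.card) else 0 := by
  set t : ℝ := Real.tanh β with ht_def
  set T₁ := tJoins G Set.univ {a 0, a 1} with hT₁_def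
  set T₂ := tJoins G Set.univ {a 2, a 3} with hT₂_def
  set Z₁ := loopO1PartitionFunction G t {a 0, a 1} with hZ₁_def
  set Z₂ := loopO1PartitionFunction G t {a 2, a 3} with hZ₂_def
  set g : ℝ := isingCorr G Finset.univ β 0 .free {a 2, a 3} with hg_def
  have ht : 0 ≤ t := by
    rw [ht_def, Real.tanh_eq_sinh_div_cosh]
    exact div_nonneg (Real.sinh_nonneg_iff.2 hβ) (Real.cosh_pos _).le
  have hg : 0 ≤ g :=
    GKSInequalities.gks_one_holds G hβ le_rfl (Or.inl rfl) (Finset.subset_univ _)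
  have hZ₁ : Z₁ = ∑ F ∈ T₁, t ^ #F := by
    rw [hZ₁_def, DepletionBound.loopO1PartitionFunction_eq_hteSum, DepletionBound.sum_tJoins_pow_eq_hteSum]
  have hZ₂ : Z₂ = ∑ F ∈ T₂, t ^ #F := by
    rw [hZ₂_def, DepletionBound.loopO1PartitionFunction_eq_hteSum, DepletionBound.sum_tJoins_pow_eq_hteSum]
  have hZ₂nn : 0 ≤ Z₂ := loopO1PartitionFunction_nonneg G ht _
  -- a `T`-join of the pair `{a₂, a₃}` joins `a₂` to `a₃` (handshake in the component of `a₂`)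
  have hpair : ∀ {F : Finset (Sym2 V)}, F ∈ T₂ →
      (fromEdgeSet (↑F : Set (Sym2 V))).Reachable (a 2) (a 3) := by
    intro F hF
    by_cases hxy : a 2 = a 3
    · rw [hxy]
    obtain ⟨hFG, -, hpar⟩ := (mem_tJoins G).1 hF
    have hFE : ∀ e ∈ F, ¬ e.IsDiag := fun e he =>
      G.not_isDiag_of_mem_edgeSet (mem_edgeFinset.1 (hFG he))
    have hx : Odd (edgeDeg F (a 2)) := (hpar (a 2)).2 (by simp)
    obtain ⟨w, hw, hreach, hwodd⟩ := exists_reachable_odd_of_odd F hFE hx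
    have hw' : w ∈ ({a 2, a 3} : Finset V) := (hpar w).1 hwodd
    rw [Finset.mem_insert, Finset.mem_singleton] at hw'
    rcases hw' with h | h
    · exact absurd h hw
    · exact h ▸ hreach
  -- the joint sum of one strand configuration, and the depleted correlation
  set J : Finset (Sym2 V) → ℝ := fun F₁ => ∑ F₂ ∈ T₂,
      if (SimpleGraph.fromEdgeSet ((↑F₁ : Set (Sym2 V)) ∪ ↑F₂)).Reachable (a 0) (a 2)
      then t ^ (#F₁ + #F₂) else 0 with hJ_def
  set D : Finset (Sym2 V) → ℝ := fun F₁ =>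
      if ¬ (SimpleGraph.fromEdgeSet (↑F₁ : Set (Sym2 V))).Reachable (a 0) (a 2) ∧
          ¬ (SimpleGraph.fromEdgeSet (↑F₁ : Set (Sym2 V))).Reachable (a 0) (a 3) then
        isingCorr G (Finset.univ.filter (fun v : V =>
          ¬ (SimpleGraph.fromEdgeSet (↑F₁ : Set (Sym2 V))).Reachable (a 0) v)) β 0 .free {a 2, a 3}
      else 0
    with hD_def
  have hJnn : ∀ F₁, 0 ≤ J F₁ := fun F₁ =>
    Finset.sum_nonneg fun F₂ _ => by
      split_ifs
      · exact pow_nonneg ht _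
      · exact le_rfl
  -- (**) the per-configuration inequality
  have key : ∀ F₁ ∈ T₁, t ^ #F₁ * Z₂ * g - t ^ #F₁ * Z₂ * D F₁ ≤ J F₁ * g := by
    intro F₁ _
    have hDnn : 0 ≤ D F₁ := by
      simp only [hD_def]
      split_ifs
      · exact isingCorr_free_pair_nonneg G _ hβ _ _
      · exact le_rfl
    by_cases hA : (SimpleGraph.fromEdgeSet (↑F₁ : Set (Sym2 V))).Reachable (a 0) (a 2) ∨
        (SimpleGraph.fromEdgeSet (↑F₁ : Set (Sym2 V))).Reachable (a 0) (a 3)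
    · -- sure join: the `a₀`-cluster already contains `a₂`, or `a₃` (joined to `a₂` by `F₂`)
      have hJeq : J F₁ = t ^ #F₁ * Z₂ := by
        simp only [hJ_def]
        rw [hZ₂, Finset.mul_sum]
        refine Finset.sum_congr rfl fun F₂ hF₂ => ?_
        rw [if_pos, pow_add]
        rcases hA with h | h
        · exact h.mono (fromEdgeSet_mono Set.subset_union_left)
        · exact (h.mono (fromEdgeSet_mono Set.subset_union_left)).trans
            ((hpair hF₂).symm.mono
              (fromEdgeSet_mono Set.subset_union_right))
      rw [hJeq]
      have : 0 ≤ t ^ #F₁ * Z₂ * D F₁ := mul_nonneg (mul_nonneg (pow_nonneg ht _) hZ₂nn) hDnn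
      linarith
    · push Not at hA
      obtain ⟨h2, h3⟩ := hA
      -- the `a₀`-cluster `S` avoids `a₂, a₃`: depletion bound with this `S`
      set S : Finset V := Finset.univ.filter (fun v : V =>
        (SimpleGraph.fromEdgeSet (↑F₁ : Set (Sym2 V))).Reachable (a 0) v) with hS_def
      have h2S : a 2 ∉ S := by simp [hS_def, h2]
      have h3S : a 3 ∉ S := by simp [hS_def, h3]
      have hcompl : Finset.univ \ S = Finset.univ.filter (fun v : V =>
          ¬ (SimpleGraph.fromEdgeSet (↑F₁ : Set (Sym2 V))).Reachable (a 0) v) := by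
        ext v
        simp [hS_def]
      have hDS := hD S h2S h3S
      rw [hcompl] at hDS
      have hDF : D F₁ = isingCorr G (Finset.univ.filter (fun v : V =>
          ¬ (SimpleGraph.fromEdgeSet (↑F₁ : Set (Sym2 V))).Reachable (a 0) v)) β 0 .free {a 2, a 3} := by
        simp only [hD_def]
        rw [if_pos ⟨h2, h3⟩]
      rw [← hDF] at hDS
      -- `hDS : Avoid * g ≤ Z₂ * D F₁`
      set avoid : Finset (Sym2 V) → Prop := fun F =>
        ∀ v ∈ S, ¬ (SimpleGraph.fromEdgeSet (↑F : Set (Sym2 V))).Reachable (a 2) v with havoid_def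
      have hsplit := Finset.sum_filter_add_sum_filter_not T₂ avoid (fun F => t ^ #F)
      -- every non-avoiding `F₂` joins `a₀` to `a₂` through the meeting vertex
      have hJge : t ^ #F₁ * ∑ F ∈ T₂.filter (fun F => ¬ avoid F), t ^ #F ≤ J F₁ := by
        rw [Finset.mul_sum]
        calc ∑ F ∈ T₂.filter (fun F => ¬ avoid F), t ^ #F₁ * t ^ #F
            = ∑ F ∈ T₂.filter (fun F => ¬ avoid F),
                (if (SimpleGraph.fromEdgeSet ((↑F₁ : Set (Sym2 V)) ∪ ↑F)).Reachable (a 0) (a 2)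
                  then t ^ (#F₁ + #F) else 0) := by
              refine Finset.sum_congr rfl fun F hF => ?_
              have hna : ¬ avoid F := (Finset.mem_filter.1 hF).2
              simp only [havoid_def, not_forall, not_not] at hna
              obtain ⟨v, hv, hreach⟩ := hna
              have hv' : (SimpleGraph.fromEdgeSet (↑F₁ : Set (Sym2 V))).Reachable (a 0) v := by
                simpa [hS_def] using hv
              rw [if_pos, pow_add]
              exact (hv'.mono (fromEdgeSet_mono Set.subset_union_left)).trans
                (hreach.symm.mono (fromEdgeSet_mono Set.subset_union_right))
          _ ≤ J F₁ := by
              simp only [hJ_def]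
              refine Finset.sum_le_sum_of_subset_of_nonneg (Finset.filter_subset _ _) ?_
              intro F _ _
              split_ifs
              · exact pow_nonneg ht _
              · exact le_rfl
      have hrest : ∑ F ∈ T₂.filter (fun F => ¬ avoid F), t ^ #F =
          Z₂ - ∑ F ∈ T₂.filter avoid, t ^ #F := by
        rw [hZ₂]; linarith
      rw [hrest] at hJge
      have h1 := mul_le_mul_of_nonneg_left hDS (pow_nonneg ht #F₁)
      have h2 := mul_le_mul_of_nonneg_right hJge hg
      nlinarith [h1, h2, mul_nonneg (pow_nonneg ht #F₁) hg]
  -- sum (**) over the strand configurations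
  have hsum : ∑ F₁ ∈ T₁, (t ^ #F₁ * Z₂ * g - t ^ #F₁ * Z₂ * D F₁) ≤ ∑ F₁ ∈ T₁, J F₁ * g :=
    Finset.sum_le_sum key
  have hL : ∑ F₁ ∈ T₁, (t ^ #F₁ * Z₂ * g - t ^ #F₁ * Z₂ * D F₁) =
      Z₁ * Z₂ * g - Z₂ * ∑ F₁ ∈ T₁, t ^ #F₁ * D F₁ := by
    rw [Finset.sum_sub_distrib, hZ₁, Finset.sum_mul, Finset.sum_mul, Finset.mul_sum]
    congr 1
    refine Finset.sum_congr rfl fun _ _ => ?_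
    ring
  have hR : ∑ F₁ ∈ T₁, J F₁ * g = (∑ F₁ ∈ T₁, J F₁) * g := (Finset.sum_mul _ _ _).symm
  rw [hL, hR] at hsum
  -- the CLEAN shadow hypothesis: `Σ_F t^|F| D(F) = Σ_{F clean} t^|F| ⟨σ₂σ₃⟩_{depl F}`
  have hsumD : ∑ F₁ ∈ T₁, t ^ #F₁ * D F₁ =
      ∑ F ∈ T₁.filter (fun F : Finset (Sym2 V) =>
          ¬ (SimpleGraph.fromEdgeSet (↑F : Set (Sym2 V))).Reachable (a 0) (a 2) ∧
          ¬ (SimpleGraph.fromEdgeSet (↑F : Set (Sym2 V))).Reachable (a 0) (a 3)),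
        t ^ #F * isingCorr G (Finset.univ.filter (fun v : V =>
          ¬ (SimpleGraph.fromEdgeSet (↑F : Set (Sym2 V))).Reachable (a 0) v)) β 0 .free {a 2, a 3} := by
    rw [Finset.sum_filter]
    refine Finset.sum_congr rfl fun F _ => ?_
    simp only [hD_def]
    split_ifs <;> simp
  have hS' : Z₂ * ∑ F₁ ∈ T₁, t ^ #F₁ * D F₁ ≤ Z₂ * ((1 - c) * Z₁ * g) := by
    rw [hsumD]
    exact mul_le_mul_of_nonneg_left hS hZ₂nn
  have hmain : c * Z₁ * Z₂ * g ≤ (∑ F₁ ∈ T₁, J F₁) * g := by nlinarith [hsum, hS']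
  -- conclude: divide by `g > 0`, or `g = 0 ⇒ Z₂ = 0`
  by_cases hg0 : g = 0
  · have hZ₂0 : Z₂ = 0 := by
      have hq := isingCorr_univ_mul_loopO1_empty G β ({a 2, a 3} : Finset V)
      rw [← ht_def, ← hZ₂_def, ← hg_def, hg0, zero_mul] at hq
      exact hq.symm
    rw [hZ₂0, mul_zero]
    exact Finset.sum_nonneg fun F₁ _ => hJnn F₁
  · have hgpos : 0 < g := lt_of_le_of_ne hg (Ne.symm hg0)
    exact le_of_mul_le_mul_right (by linarith [hmain]) hgpos


end General

end Summit.CriticalPhenomena.Ising3DConformalLimit.Theorems.StrandShadowSketch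

end
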